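import Mathlib
import Literature.Computability.AlgebraicComplexity.HessianAtOrigin
import Literature.Computability.AlgebraicComplexity.MignonRessayreBound
import Summits.ValiantsHypothesis.ValiantsHypothesis.Theorems.GrenetZeonTwoDimCoefficientsUnitCase
import Summits.ValiantsHypothesis.ValiantsHypothesis.Theorems.GrenetZeonTwoDimCoefficientsScalingClosureRank

/-!
# Crux `GrenetZeon.TwoDimCoefficients` (stmt-ValiantsHypothesis-8062), stub `stub_dualUnipotent`:
# scaling-closure — the LIMIT STEP, closed: `n² ≤ r` from any scaling family

The scaling-closure argument for the unipotent dual model (`per_n = αc + β·tr(adj A·B)`, `det A ≡ c ≠ 0`)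
has three parts: (1) SCALING ALGEBRA — from the data build a one-parameter polynomial family
`P(z, δ)` (the rescaled determinant `det(A + δ^n B)(z/δ)`, cleared of denominators) and a polynomial
matrix `H(z, δ)` (its rescaled Hessian in `z`) with `P(z, 0) = κ + μ·per_n(z)` and `H(z, 0)` of the rank of
`Hess per_n(z)`; (2) MIGNON–RESSAYRE OFF `δ = 0` — `rank H(x) ≤ 2m` at every zero `x` of `P` with
`δ ≠ 0` (✓ `rank_hess0_det_le` applied to the affine matrix `A + ε B`, `ε = δ^n`); (3) the LIMIT STEP.
This file closes (3) once and for all, BY NAME, for any family: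

* ★ `sq_le_of_scalingFamily` — if `P ∈ ℂ[z, δ]` and a polynomial matrix `H` satisfy
  (h0) `P(z, 0) = κ + μ·per_n(z)` for all `z` with `κ, μ ≠ 0`,
  (hH) `rank Hess per_n(z) ≤ rank H(z, 0)` for all `z`,
  (hMR) `rank H(x) ≤ r` at every zero `x` of `P` with `x_δ ≠ 0`,
  then `n² ≤ r` (`n ≥ 3`).
  Proof: a dilate `z₀ = s·y` of a point `y` with `per_n(y) ≠ 0` and invertible Hessian
  (✓ `exists_eval_perPoly_ne_zero_and_isUnit_hess0`) is a zero of `P(·, 0)` (`s^n = −κ/(μ·per_n(y))`,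
  ℂ algebraically closed) with `rank Hess per_n(z₀) = n²`; Euler's identity gives a coordinate with
  `∂P/∂z_{ij}(z₀, 0) = μ·∂per_n/∂z_{ij}(z₀) ≠ 0`; the rank-form engine
  ✓ `exists_zero_off_coord_le_rank_mvPolynomial` produces a zero of `P` with `δ ≠ 0` and `rank H ≥ n²`.
* `eval_pderiv_some_eq_of_restrict` — the derivative bookkeeping: `∂_{z_{ij}} P (z, 0) = μ·∂_{ij} per_n(z)`
  from (h0) (uniqueness of derivatives along the line `t ↦ (z + t e_{ij}, 0)`).

So the stub's Hessian route is reduced EXACTLY to the scaling algebra (1)+(2): exhibiting `(P, H)` with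
(h0), (hH), (hMR) for `r = 2m`.  With the companions present (`deg D_k = kn`) (h0) fails and the shadow
acquires extra terms — the documented limit of the method (memo SIXTEENTH-HAND.md; PROFILE-BARRIER).

HONEST FRAMING: a reduction/instrument; no scaling family is constructed here; the stub `DualUnipotentBound`,
the crux and `VP ≠ VNP` are untouched.

References: T. Mignon, N. Ressayre, Int. Math. Res. Not. 2004:79, Thm. 1.1 (point with non-degenerate
Hessian; tree `exists_eval_perPoly_ne_zero_and_isUnit_hess0`); L. Euler (identity for forms; Mathlib
`IsHomogeneous.sum_X_mul_pderiv`).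
-/

-- single-conjunct layout `Summits/ValiantsHypothesis/ValiantsHypothesis`: the duplicated namespace
-- component is mandated by the tree.
set_option linter.dupNamespace false
set_option autoImplicit false

noncomputable section

namespace Summit.ValiantsHypothesis.ValiantsHypothesis.Theorems.GrenetZeonTwoDimCoefficients.ScalingClosure

open MvPolynomial Matrix Filter Topology
open Literature.Computability.AlgebraicComplexity
open Summit.ValiantsHypothesis.ValiantsHypothesis.Cruxes.TwoDimCoefficients.DimTwoCases

variable {σ : Type*} [Fintype σ] [DecidableEq σ]

omit [Fintype σ] in
/-- The line `t ↦ (z, 0) + t·e_{some i}` in `ℂ^{Option σ}` is the image of the line `t ↦ z + t·e_i` in the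
slice `δ = 0`. [folklore] -/
theorem elim_add_smul_single (z : σ → ℂ) (i : σ) (t : ℂ) :
    (fun o : Option σ => o.elim (0 : ℂ) z) + t • (Pi.single (some i) (1 : ℂ) : Option σ → ℂ) =
      fun o : Option σ => o.elim (0 : ℂ) (z + t • (Pi.single i (1 : ℂ) : σ → ℂ)) := by
  funext o
  cases o with
  | none => simp
  | some s =>
    by_cases hs : s = i
    · subst hs
      simp
    · simp [hs]

omit [Fintype σ] in
/-- **Derivative bookkeeping on the slice `δ = 0`.**  If `P(z, 0) = κ + μ·Q(z)` for all `z`, then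
`(∂_{some i} P)(z, 0) = μ·(∂_i Q)(z)` (uniqueness of the derivative along the line
`t ↦ (z + t e_i, 0)`; ✓ `hasDerivAt_eval_line`). [folklore] -/
theorem eval_pderiv_some_eq_of_restrict (P : MvPolynomial (Option σ) ℂ) (Q : MvPolynomial σ ℂ)
    (κ μ : ℂ) (h0 : ∀ z : σ → ℂ, eval (fun o : Option σ => o.elim (0 : ℂ) z) P = κ + μ * eval z Q)
    (z : σ → ℂ) (i : σ) :
    eval (fun o : Option σ => o.elim (0 : ℂ) z) (pderiv (some i) P) = μ * eval z (pderiv i Q) := by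
  have h1 := hasDerivAt_eval_line P (fun o : Option σ => o.elim (0 : ℂ) z) (some i)
  have h2 : HasDerivAt (fun t : ℂ => κ + μ * eval (z + t • (Pi.single i (1 : ℂ) : σ → ℂ)) Q)
      (μ * eval z (pderiv i Q)) 0 := by
    simpa using ((hasDerivAt_eval_line Q z i).const_mul μ).const_add κ
  have h3 : (fun t : ℂ => eval ((fun o : Option σ => o.elim (0 : ℂ) z) +
      t • (Pi.single (some i) (1 : ℂ) : Option σ → ℂ)) P) =
      fun t : ℂ => κ + μ * eval (z + t • (Pi.single i (1 : ℂ) : σ → ℂ)) Q := by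
    funext t
    rw [elim_add_smul_single, h0]
  rw [h3] at h1
  exact h1.unique h2

omit [DecidableEq σ] in
/-- At a point where a form of positive degree does not vanish, some first partial does not vanish
(Euler's identity). [folklore] -/
theorem exists_eval_pderiv_ne_zero_of_isHomogeneous (Q : MvPolynomial σ ℂ) {d : ℕ}
    (hQ : Q.IsHomogeneous d) (hd : d ≠ 0) (z : σ → ℂ) (hz : eval z Q ≠ 0) :
    ∃ i : σ, eval z (pderiv i Q) ≠ 0 := by
  by_contra hall
  push Not at hall
  have hE := congrArg (eval z) hQ.sum_X_mul_pderiv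
  rw [map_sum, map_nsmul] at hE
  have hzero : ∑ i : σ, eval z (X i * pderiv i Q) = 0 :=
    Finset.sum_eq_zero fun i _ => by rw [map_mul, hall i, mul_zero]
  rw [hzero, nsmul_eq_mul] at hE
  exact mul_ne_zero (by exact_mod_cast hd) hz hE.symm

/-- ★ **The limit step of the scaling-closure argument, closed by name.**  Let `n = k + 3`,
`P ∈ ℂ[z_{ij}, δ]` (`δ` = the coordinate `none`) and `H` an `n² × n²` matrix over the same ring with
(h0) `P(z, 0) = κ + μ·per_n(z)` (`κ, μ ≠ 0`), (hH) `rank Hess per_n(z) ≤ rank H(z, 0)`, and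
(hMR) `rank H(x) ≤ r` at every zero `x` of `P` off the slice `δ = 0`.  Then `n² ≤ r`.
(Zero of `P(·,0)` with full-rank Hessian by dilation of ✓ `exists_eval_perPoly_ne_zero_and_isUnit_hess0`;
smooth direction by Euler; transport by ✓ `exists_zero_off_coord_le_rank_mvPolynomial`.)
[cite: MignonRessayre2004, Thm. 1.1 — the non-degenerate point; folklore assembly] -/
theorem sq_le_of_scalingFamily {k r : ℕ}
    (P : MvPolynomial (Option (Fin (k + 3) × Fin (k + 3))) ℂ)
    (H : Matrix (Fin (k + 3) × Fin (k + 3)) (Fin (k + 3) × Fin (k + 3))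
      (MvPolynomial (Option (Fin (k + 3) × Fin (k + 3))) ℂ))
    (κ μ : ℂ) (hκ : κ ≠ 0) (hμ : μ ≠ 0)
    (h0 : ∀ z : Fin (k + 3) × Fin (k + 3) → ℂ,
      eval (fun o : Option (Fin (k + 3) × Fin (k + 3)) => o.elim (0 : ℂ) z) P =
        κ + μ * eval z (perPoly (Fin (k + 3)) ℂ))
    (hH : ∀ z : Fin (k + 3) × Fin (k + 3) → ℂ,
      (hess0 (transl z (perPoly (Fin (k + 3)) ℂ))).rank ≤
        (H.map (eval (fun o : Option (Fin (k + 3) × Fin (k + 3)) => o.elim (0 : ℂ) z))).rank)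
    (hMR : ∀ x : Option (Fin (k + 3) × Fin (k + 3)) → ℂ, x none ≠ 0 → eval x P = 0 →
      (H.map (eval x)).rank ≤ r) :
    (k + 3) ^ 2 ≤ r := by
  classical
  -- a point with `per ≠ 0` and invertible Hessian, dilated onto the level set `per = -κ/μ`
  obtain ⟨y, hy, hyU⟩ := exists_eval_perPoly_ne_zero_and_isUnit_hess0 k
  obtain ⟨s, hs⟩ := IsAlgClosed.exists_pow_nat_eq
    (-κ / (μ * eval y (perPoly (Fin (k + 3)) ℂ))) (Nat.succ_pos (k + 2))
  have hsn : s ^ (k + 3) * (μ * eval y (perPoly (Fin (k + 3)) ℂ)) = -κ := by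
    rw [hs]
    field_simp
  have hs0 : s ≠ 0 := by
    rintro rfl
    rw [zero_pow (Nat.succ_ne_zero _), zero_mul] at hsn
    exact hκ (neg_eq_zero.mp hsn.symm)
  set z₀ : Fin (k + 3) × Fin (k + 3) → ℂ := s • y with hz₀
  set a : Option (Fin (k + 3) × Fin (k + 3)) → ℂ := fun o => o.elim (0 : ℂ) z₀ with ha
  have hper : eval z₀ (perPoly (Fin (k + 3)) ℂ) = s ^ (k + 3) * eval y (perPoly (Fin (k + 3)) ℂ) := by
    rw [hz₀, eval_smul_perPoly]
  -- `a` is a zero of `P`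
  have hPa : eval a P = 0 := by
    rw [ha, h0, hper]
    linear_combination hsn
  -- full Hessian rank at `z₀`
  have hrank : (k + 3) ^ 2 ≤ (H.map (eval a)).rank := by
    refine le_trans ?_ (hH z₀)
    have hU : IsUnit (hess0 (transl z₀ (perPoly (Fin (k + 3)) ℂ))) := by
      rw [Matrix.isUnit_iff_isUnit_det, hz₀, hess0_transl_smul_perPoly, det_smul]
      exact (IsUnit.pow _ (isUnit_iff_ne_zero.mpr (pow_ne_zero _ hs0))).mul hyU
    rw [rank_of_isUnit _ hU, Fintype.card_prod, Fintype.card_fin]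
    nlinarith
  -- a smooth `z`-direction at `a` (Euler)
  have hper0 : eval z₀ (perPoly (Fin (k + 3)) ℂ) ≠ 0 := by
    rw [hper]
    exact mul_ne_zero (pow_ne_zero _ hs0) hy
  have hhom : (perPoly (Fin (k + 3)) ℂ).IsHomogeneous (k + 3) := by
    simpa [Fintype.card_fin] using perPoly_isHomogeneous (n := Fin (k + 3)) (k := ℂ)
  obtain ⟨i, hi⟩ := exists_eval_pderiv_ne_zero_of_isHomogeneous _ hhom (Nat.succ_ne_zero _) z₀ hper0
  have hPj : eval a (pderiv (some i) P) ≠ 0 := by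
    rw [ha, eval_pderiv_some_eq_of_restrict P (perPoly (Fin (k + 3)) ℂ) κ μ h0 z₀ i]
    exact mul_ne_zero hμ hi
  -- transport along a curve leaving the slice `δ = 0`
  obtain ⟨x, hxδ, hxP, hxr⟩ := exists_zero_off_coord_le_rank_mvPolynomial P H a
    (i₀ := none) (j := some i) (Option.some_ne_none i) hPa hPj hrank
  have hx0 : x none ≠ 0 := by simpa [ha] using hxδ
  exact hxr.trans (hMR x hx0 hxP)

end Summit.ValiantsHypothesis.ValiantsHypothesis.Theorems.GrenetZeonTwoDimCoefficients.ScalingClosure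

end
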